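import Summits.QuantumFields.BalabanUV.Gaps.EndDrawdownProfile

/-!
# Gaps / EndDrawdownCooperator — the TUNED COOPERATOR: if a real sequence `b` has bounded drawdown below EVERY line of negative slope
# (`DwSeq b (−2⁻ⁿ)` for all `n`), then the profile realization `β_{k+1} = b_k + Φ_t(g_k)` of `Gaps/EndDrawdownProfile`, with thresholds `t`
# tuned to the drawdown bounds `M_n` of `b`, HAS `EndpointExistence` — for EVERY forward-generated construction, by FORWARD SHOOTING with a
# TWO-LEVEL BARRIER in place of the uniform partial-sum bound of the tree's W-β socket (`FlowStepRuns.endpointExistence_of_partialSums`): on the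
# box `]0,γ]` with `A := 1∕γ²`, whenever the clamped run sits below `4A` its coupling is `≥ γ∕2 ≥ 2t_n`, so the help is `≥ 2⁻ⁿ`, and the level `n`
# is chosen with `M_n ≤ 3A`; hence (no climb) the run started at `g₀ = γ` never exceeds `A + M_n ≤ 4A ≤ 1∕g²`, and (barrier) a run ending at
# `1∕g² ≥ 4A` never falls below `4A − M_n ≥ A` before its first passage above `4A` — the clamp is inactive and the IVT trajectory is genuine.
# §2 isolates the argument as the stand-alone BARRIER SHOOTING LEMMA `run_of_bandBarrier` for ANY history family `b_k + H(g_k)` (help `≤ Hmax` on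
# `]0,γ]`, `≥ ε` on the coupling band `[γ∕2, γ]`, windows `Σ(b+ε) ≥ −M`, `M ≤ 3∕γ²` ⟹ runs to every target `g ≤ γ∕2` at every cutoff, every
# forward-generated construction), reused by `Gaps/EndDrawdownLinearRoad` for the linear help `C·g` (this seat's own leaf; cell pub-balaban-gaps,
# seat g1-p3 GEN 9, rows CAP ∕ tail «split ∕ weakening»; file 11 of «the one-loop interface of the END statement»; consumed by
# `Gaps/EndDrawdownEverySlopeDecided` and `Gaps/EndDrawdownLinearRoad`)

HONEST FRAMING (cell rule, page 1 of everything): [folklore] shooting arithmetic (the tree's clamped forward run `FlowStep.Y`, its continuity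
`continuousOn_Y`, the intermediate value theorem) for a TOY family on the tree's carrier; NO object of Bałaban's occurs; the cooperator is a
hypothesis-free WITNESS deciding what the cell's END-grade statement reads of a one-loop sequence over the every-slope class (row (D4)'s located
UNPRINTED currency).  Nothing of Bałaban's is asserted; 0∕6 binders; 0 coefficients certified; NOT [I] Thm 2, NOT `BetaPertH`, NOT the continuum
limit, NOT Clay.

CITATION HEADER (tags CONTEXT ONLY).  [I] = T. Bałaban, Commun. Math. Phys. **109** (1987) 249–301 [Balaban1987RG1]: (0.20) p. 256, Thm 2
p. 259 (first sentence), Thm 3 p. 264, (2.12)–(2.14) p. 268.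
-/

namespace Summit.QuantumFields.BalabanUV.Gaps.EndDrawdownCooperator

open Literature.MathematicalPhysics.QuantumFieldTheory.Balaban1983to89
open Literature.MathematicalPhysics.QuantumFieldTheory.Balaban1983to89.FlowStep
open Literature.MathematicalPhysics.QuantumFieldTheory.Balaban1983to89.FlowStepRuns
open Literature.MathematicalPhysics.QuantumFieldTheory.Balaban1983to89.DagBinding
open Summit.QuantumFields.BalabanUV.Gaps.CapSignsConstRoad (EverySlope)
open Summit.QuantumFields.BalabanUV.Gaps.EndDrawdownSeq
open Summit.QuantumFields.BalabanUV.Gaps.EndDrawdownProfile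
open Finset

noncomputable section

variable {b : ℕ → ℝ}

/-! ## §1 The drawdown bounds of `b` and the tuned thresholds -/

/-- The drawdown bound of `b` below the line of slope `−2⁻ⁿ`, chosen nonnegative. [folklore] -/
def coopM (hD : ∀ n : ℕ, DwSeq b (-(((2 : ℝ)⁻¹) ^ n))) (n : ℕ) : ℝ :=
  Classical.choose (hD n).exists_nonneg

/-- Its specification: `0 ≤ M_n` and `−M_n ≤ Σ_{[k,m)} (b_j + 2⁻ⁿ)`. [folklore] -/
theorem coopM_spec (hD : ∀ n : ℕ, DwSeq b (-(((2 : ℝ)⁻¹) ^ n))) (n : ℕ) :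
    0 ≤ coopM hD n ∧ ∀ k m : ℕ, k ≤ m → -coopM hD n ≤ ∑ j ∈ Finset.Ico k m, (b j + ((2 : ℝ)⁻¹) ^ n) := by
  obtain ⟨h0, h⟩ := Classical.choose_spec (hD n).exists_nonneg
  refine ⟨h0, fun k m hkm => ?_⟩
  have e : ∑ j ∈ Finset.Ico k m, (b j + ((2 : ℝ)⁻¹) ^ n) = ∑ j ∈ Finset.Ico k m, (b j - -(((2 : ℝ)⁻¹) ^ n)) :=
    Finset.sum_congr rfl fun j _ => by ring
  rw [e]
  exact h k m hkm

/-- The cumulative bound `M′_n := 1 + Σ_{i<n+2} M_i` (`≥ 1`, `≥ M_n`, `≥ M_{n+1}`, monotone). [folklore] -/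
def coopM' (hD : ∀ n : ℕ, DwSeq b (-(((2 : ℝ)⁻¹) ^ n))) (n : ℕ) : ℝ :=
  1 + ∑ i ∈ Finset.range (n + 2), coopM hD i

/-- `1 ≤ M′_n`. [folklore] -/
theorem one_le_coopM' (hD : ∀ n : ℕ, DwSeq b (-(((2 : ℝ)⁻¹) ^ n))) (n : ℕ) : 1 ≤ coopM' hD n :=
  le_add_of_nonneg_right (Finset.sum_nonneg fun i _ => (coopM_spec hD i).1)

/-- `M_n ≤ M′_n`. [folklore] -/
theorem coopM_le_coopM' (hD : ∀ n : ℕ, DwSeq b (-(((2 : ℝ)⁻¹) ^ n))) (n : ℕ) : coopM hD n ≤ coopM' hD n := by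
  have h := Finset.single_le_sum (f := fun i => coopM hD i) (fun i _ => (coopM_spec hD i).1)
    (Finset.mem_range.mpr (show n < n + 2 by omega))
  unfold coopM'
  linarith

/-- `M_{n+1} ≤ M′_n`. [folklore] -/
theorem coopM_succ_le_coopM' (hD : ∀ n : ℕ, DwSeq b (-(((2 : ℝ)⁻¹) ^ n))) (n : ℕ) : coopM hD (n + 1) ≤ coopM' hD n := by
  have h := Finset.single_le_sum (f := fun i => coopM hD i) (fun i _ => (coopM_spec hD i).1)
    (Finset.mem_range.mpr (show n + 1 < n + 2 by omega))
  unfold coopM'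
  linarith

/-- `M′` is monotone. [folklore] -/
theorem coopM'_mono (hD : ∀ n : ℕ, DwSeq b (-(((2 : ℝ)⁻¹) ^ n))) : Monotone (coopM' hD) := by
  refine monotone_nat_of_le_succ fun n => ?_
  unfold coopM'
  rw [Finset.sum_range_succ _ (n + 2)]
  linarith [(coopM_spec hD (n + 2)).1]

/-- The cooperator's thresholds `t_n := 2⁻ⁿ · √(3 ∕ M′_n) ∕ 4`. [folklore] -/
def coopT (hD : ∀ n : ℕ, DwSeq b (-(((2 : ℝ)⁻¹) ^ n))) (n : ℕ) : ℝ :=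
  ((2 : ℝ)⁻¹) ^ n * (Real.sqrt (3 / coopM' hD n) / 4)

/-- `0 < t_n`. [folklore] -/
theorem coopT_pos (hD : ∀ n : ℕ, DwSeq b (-(((2 : ℝ)⁻¹) ^ n))) (n : ℕ) : 0 < coopT hD n := by
  have h1 := one_le_coopM' hD n
  unfold coopT
  positivity

/-- The thresholds are antitone. [folklore] -/
theorem coopT_antitone (hD : ∀ n : ℕ, DwSeq b (-(((2 : ℝ)⁻¹) ^ n))) : Antitone (coopT hD) := by
  refine antitone_nat_of_succ_le fun n => ?_
  unfold coopT
  have h1 := one_le_coopM' hD n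
  have hmono := coopM'_mono hD (Nat.le_succ n)
  have hsq : Real.sqrt (3 / coopM' hD (n + 1)) ≤ Real.sqrt (3 / coopM' hD n) :=
    Real.sqrt_le_sqrt (div_le_div_of_nonneg_left (by norm_num) (by linarith) hmono)
  have hpow : ((2 : ℝ)⁻¹) ^ (n + 1) ≤ ((2 : ℝ)⁻¹) ^ n := pow_le_pow_of_le_one (by norm_num) (by norm_num) (Nat.le_succ _)
  exact mul_le_mul hpow (by linarith) (by positivity) (pow_nonneg (by norm_num) n)

/-- `t_n ≤ 2⁻ⁿ` (since `√(3∕M′_n) ≤ √3 ≤ 2`). [folklore] -/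
theorem coopT_le (hD : ∀ n : ℕ, DwSeq b (-(((2 : ℝ)⁻¹) ^ n))) (n : ℕ) : coopT hD n ≤ ((2 : ℝ)⁻¹) ^ n := by
  have h1 := one_le_coopM' hD n
  have h3 : 3 / coopM' hD n ≤ 4 := (div_le_iff₀ (by linarith)).mpr (by linarith)
  have hs : Real.sqrt (3 / coopM' hD n) ≤ 2 := by
    rw [show (2 : ℝ) = Real.sqrt (2 ^ 2) by rw [Real.sqrt_sq (by norm_num)]]
    exact Real.sqrt_le_sqrt (by linarith)
  unfold coopT
  have hp : 0 ≤ ((2 : ℝ)⁻¹) ^ n := pow_nonneg (by norm_num) n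
  nlinarith

/-- **TUNING**: `(4 t_n)² · M′_n ≤ 3`. [folklore] -/
theorem coopT_tune (hD : ∀ n : ℕ, DwSeq b (-(((2 : ℝ)⁻¹) ^ n))) (n : ℕ) : (4 * coopT hD n) ^ 2 * coopM' hD n ≤ 3 := by
  have h1 := one_le_coopM' hD n
  have hsq : Real.sqrt (3 / coopM' hD n) ^ 2 = 3 / coopM' hD n := Real.sq_sqrt (by positivity)
  have hp : ((2 : ℝ)⁻¹) ^ n ≤ 1 := pow_le_one₀ (by norm_num) (by norm_num)
  have hp0 : 0 ≤ ((2 : ℝ)⁻¹) ^ n := pow_nonneg (by norm_num) n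
  have e : (4 * coopT hD n) ^ 2 * coopM' hD n = (((2 : ℝ)⁻¹) ^ n) ^ 2 * (Real.sqrt (3 / coopM' hD n) ^ 2 * coopM' hD n) := by
    unfold coopT; ring
  rw [e, hsq, div_mul_cancel₀ _ (by linarith : coopM' hD n ≠ 0)]
  nlinarith

/-- THE LEVEL OF A BOX · for `0 < γ ≤ 4t_0` there is a level `n` with `4 t_n ≤ γ` (the help is `≥ 2⁻ⁿ` on couplings `≥ γ∕2`) AND `M_n γ² ≤ 3`
(the drawdown bound fits in the band `[A, 4A]`, `A = 1∕γ²`) — the least `n` with `4t_n ≤ γ`. [folklore] -/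
theorem exists_level (hD : ∀ n : ℕ, DwSeq b (-(((2 : ℝ)⁻¹) ^ n))) {γ : ℝ} (hγ : 0 < γ) (hγ2 : γ ≤ 4 * coopT hD 0) :
    ∃ n : ℕ, 4 * coopT hD n ≤ γ ∧ coopM hD n * γ ^ 2 ≤ 3 := by
  classical
  have hex : ∃ m : ℕ, 4 * coopT hD m ≤ γ := by
    obtain ⟨m, hm⟩ := exists_inv_two_pow_lt (show 0 < γ / 4 by positivity)
    exact ⟨m, by linarith [coopT_le hD m]⟩
  refine ⟨Nat.find hex, Nat.find_spec hex, ?_⟩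
  rcases (Nat.find hex).eq_zero_or_pos with h0 | hpos
  · rw [h0]
    have h1 : γ ^ 2 ≤ (4 * coopT hD 0) ^ 2 := pow_le_pow_left₀ hγ.le hγ2 2
    have h2 := coopT_tune hD 0
    have h3 := coopM_le_coopM' hD 0
    have h4 := (coopM_spec hD 0).1
    calc coopM hD 0 * γ ^ 2 ≤ coopM' hD 0 * (4 * coopT hD 0) ^ 2 := mul_le_mul h3 h1 (by positivity) (by linarith)
      _ ≤ 3 := by linarith
  · obtain ⟨m, hm⟩ : ∃ m, Nat.find hex = m + 1 := ⟨Nat.find hex - 1, by omega⟩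
    have hmin : ¬ (4 * coopT hD m ≤ γ) := Nat.find_min hex (by omega)
    rw [hm]
    have hlt : γ < 4 * coopT hD m := lt_of_not_ge hmin
    have h1 : γ ^ 2 ≤ (4 * coopT hD m) ^ 2 := pow_le_pow_left₀ hγ.le hlt.le 2
    have h2 := coopT_tune hD m
    have h3 := coopM_succ_le_coopM' hD m
    have h4 := (coopM_spec hD (m + 1)).1
    calc coopM hD (m + 1) * γ ^ 2 ≤ coopM' hD m * (4 * coopT hD m) ^ 2 := mul_le_mul h3 h1 (by positivity) (by linarith)
      _ ≤ 3 := by linarith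

/-! ## §2 BARRIER SHOOTING: runs at one box level from a drawdown bound that fits in the band and a help floor in the band -/

/-- Off the top of the band the clamped coupling is at least `γ∕2`: `y ≤ 4∕γ² ⟹ γ∕2 ≤ ĝ(y)`. [folklore] -/
theorem half_le_gClamp {γ : ℝ} (hγ : 0 < γ) {y : ℝ} (hy : y ≤ 4 * (1 / γ ^ 2)) : γ / 2 ≤ gClamp γ y := by
  unfold gClamp
  have hmaxpos : 0 < max y (1 / γ ^ 2) := lt_max_of_lt_right (by positivity)
  have h4 : (2 / γ) ^ 2 = 4 * (1 / γ ^ 2) := by rw [div_pow]; ring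
  have hmax : max y (1 / γ ^ 2) ≤ (2 / γ) ^ 2 := by
    rw [h4]
    exact max_le hy (by linarith [(one_div_pos.mpr (pow_pos hγ 2)).le])
  have hs : Real.sqrt (max y (1 / γ ^ 2)) ≤ 2 / γ := by
    rw [show (2 : ℝ) / γ = Real.sqrt ((2 / γ) ^ 2) by rw [Real.sqrt_sq (by positivity)]]
    exact Real.sqrt_le_sqrt hmax
  rw [le_div_iff₀ (Real.sqrt_pos.mpr hmaxpos)]
  calc γ / 2 * Real.sqrt (max y (1 / γ ^ 2)) ≤ γ / 2 * (2 / γ) := mul_le_mul_of_nonneg_left hs (by positivity)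
    _ = 1 := by field_simp

/-- **THE BARRIER SHOOTING LEMMA** (this seat) · a history family of the form `β_{k+1} = b_k + H(g_k)` on positive last couplings, (C) on the box
`]0,γ]`, help bounded above on `]0,γ]` by `Hmax` and bounded BELOW by `ε` on the band of couplings `[γ∕2, γ]`, and window sums `Σ_{[k,m)} (b + ε) ≥ −M`
with `M ≤ 3∕γ²`: then EVERY forward-generated construction has, for every target `g ∈ ]0, γ∕2]` and every `K`, a run in `]0,γ]` ending at `g_K = g`.
Forward shooting (IVT on `[g_small, γ]` for the tree's clamped run `FlowStep.Y`; `A := 1∕γ²`): NO CLIMB — started at `g₀ = γ` the clamped run never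
exceeds `A + M ≤ 4A ≤ 1∕g²` (strong induction: below `4A` the help is `≥ ε`); BARRIER — the run ending at `1∕g² ≥ 4A` is `≥ 4A − M ≥ A` at every
earlier time (window to the first later passage above `4A`); so the clamp is inactive and the trajectory is genuine.  Replaces the uniform
partial-sum bound of `FlowStepRuns.endpointExistence_of_partialSums` by a bound along the DYNAMICS. [cite: Balaban1987RG1, Thm 2 p.259 (first sentence) and (0.20) p.256] -/
theorem run_of_bandBarrier {β : HBeta} {H : ℝ → ℝ} {Hmax γ ε M : ℝ}
    (hβ : ∀ (k : ℕ) (p : Fin (k + 1) → ℝ), 0 < p (Fin.last k) → β k p = b k + H (p (Fin.last k)))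
    (hcont : BetaContH γ β) (hγ : 0 < γ) (hHmax : ∀ x, 0 < x → x ≤ γ → H x ≤ Hmax)
    (hband : ∀ x, γ / 2 ≤ x → x ≤ γ → ε ≤ H x)
    (hwin : ∀ k m : ℕ, k ≤ m → -M ≤ ∑ j ∈ Finset.Ico k m, (b j + ε)) (hM : M ≤ 3 / γ ^ 2)
    {C : B12.Construction} (hgen : ForwardGenerated C β) {g : ℝ} (hg : 0 < g) (hgle : g ≤ γ / 2) (K m : ℕ) :
    ∃ g0 : ℝ, (C ⟨K, m, g0⟩).flow.InInterval γ K ∧ (C ⟨K, m, g0⟩).flow.g K = g := by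
  set A : ℝ := 1 / γ ^ 2 with hA
  have hApos : 0 < A := by positivity
  have hM0 : 0 ≤ M := by have h := hwin 0 0 le_rfl; simp at h; linarith
  have hMA : M ≤ 3 * A := by rw [hA, ← mul_div_assoc, mul_one]; exact hM
  set Yend : ℝ := 1 / g ^ 2 with hYend
  have hYend4 : 4 * A ≤ Yend := by
    have h1 : g ^ 2 ≤ (γ / 2) ^ 2 := pow_le_pow_left₀ hg.le hgle 2
    have h2 : 1 / (γ / 2) ^ 2 ≤ 1 / g ^ 2 := one_div_le_one_div_of_le (pow_pos hg 2) h1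
    have h3 : 1 / (γ / 2) ^ 2 = 4 * A := by rw [hA]; field_simp; ring
    linarith
  -- the help along clamped runs and its bounds in the box ∕ in the band
  have hhelp : ∀ g₀ j, β j (clampPrefix β γ j g₀) = b j + H (gClamp γ (Y β γ j g₀)) := by
    intro g₀ j
    rw [hβ j _ (gClamp_pos hγ _)]
    show b j + H (gClamp γ (Y β γ ((Fin.last j : Fin (j + 1)) : ℕ) g₀)) = _
    rw [Fin.val_last]
  have hlow : ∀ y, y ≤ 4 * A → ε ≤ H (gClamp γ y) := fun y hy =>
    hband _ (half_le_gClamp hγ hy) (gClamp_le hγ _)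
  have hhigh : ∀ y, H (gClamp γ y) ≤ Hmax := fun y => hHmax _ (gClamp_pos hγ _) (gClamp_le hγ _)
  -- (W) the window inequality below the top of the band
  have hW : ∀ g₀ k k', k ≤ k' → (∀ j, k ≤ j → j < k' → Y β γ j g₀ ≤ 4 * A) → -M ≤ Y β γ k g₀ - Y β γ k' g₀ := by
    intro g₀ k k' hkk' hB
    rw [Y_sub_Y hkk']
    calc -M ≤ ∑ j ∈ Finset.Ico k k', (b j + ε) := hwin k k' hkk'
      _ ≤ ∑ j ∈ Finset.Ico k k', β j (clampPrefix β γ j g₀) := Finset.sum_le_sum fun j hj => by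
          rw [hhelp]
          linarith [hlow _ (hB j (Finset.mem_Ico.mp hj).1 (Finset.mem_Ico.mp hj).2)]
  -- (no climb) the run started at `g₀ = γ` stays below `A + M`
  have hclimb : ∀ k, Y β γ k γ ≤ A + M := by
    intro k
    induction k using Nat.strong_induction_on with
    | _ k ih =>
      have hB : ∀ j, 0 ≤ j → j < k → Y β γ j γ ≤ 4 * A := fun j _ hj => (ih j hj).trans (by linarith)
      have h := hW γ 0 k (Nat.zero_le k) hB
      rw [Y_zero] at h
      linarith
  -- IVT on `[g_small, γ]`
  set D : ℝ := max 0 (∑ j ∈ Finset.range K, (b j + Hmax)) with hDdef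
  have hD0 : 0 ≤ D := le_max_left _ _
  have hYD : 0 < Yend + D := by positivity
  set gsm : ℝ := 1 / Real.sqrt (Yend + D) with hgsm
  have hgsm_pos : 0 < gsm := by positivity
  have hgsm_sq : 1 / gsm ^ 2 = Yend + D := by
    rw [hgsm, div_pow, one_pow, Real.sq_sqrt hYD.le, one_div_one_div]
  have hgsm_le : gsm ≤ γ := by
    have h1 : 1 / γ ^ 2 ≤ 1 / gsm ^ 2 := by rw [hgsm_sq]; linarith
    have h2 : gsm ^ 2 ≤ γ ^ 2 := (one_div_le_one_div (pow_pos hγ 2) (pow_pos hgsm_pos 2)).mp h1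
    exact (pow_le_pow_iff_left₀ hgsm_pos.le hγ.le two_ne_zero).mp h2
  have hfc : ContinuousOn (Y β γ K) (Set.Icc gsm γ) :=
    (continuousOn_Y hγ hcont K).mono fun x hx => lt_of_lt_of_le hgsm_pos hx.1
  have hfγ : Y β γ K γ ≤ Yend := (hclimb K).trans (by linarith)
  have hfsm : Yend ≤ Y β γ K gsm := by
    rw [Y_eq_sub_sum K gsm, hgsm_sq]
    have h1 : ∑ j ∈ Finset.range K, β j (clampPrefix β γ j gsm) ≤ ∑ j ∈ Finset.range K, (b j + Hmax) :=
      Finset.sum_le_sum fun j _ => by rw [hhelp]; linarith [hhigh (Y β γ j gsm)]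
    have h2 : ∑ j ∈ Finset.range K, (b j + Hmax) ≤ D := le_max_right _ _
    linarith
  obtain ⟨g₀, -, hg₀⟩ := intermediate_value_Icc' hgsm_le hfc ⟨hfγ, hfsm⟩
  -- (barrier) first passage above `4A` after `k`, and the band floor `A` along the chosen run
  have hfirst : ∀ d k : ℕ, k + d = K → ∃ k', k ≤ k' ∧ k' ≤ K ∧ 4 * A ≤ Y β γ k' g₀ ∧
      ∀ j, k ≤ j → j < k' → Y β γ j g₀ ≤ 4 * A := by
    intro d
    induction d with
    | zero =>
      intro k hk
      refine ⟨k, le_rfl, by omega, ?_, fun j hj hjk => absurd hjk (by omega)⟩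
      rw [show k = K by omega, hg₀]
      exact hYend4
    | succ d ih =>
      intro k hk
      by_cases hk4 : 4 * A ≤ Y β γ k g₀
      · exact ⟨k, le_rfl, by omega, hk4, fun j hj hjk => absurd hjk (by omega)⟩
      · obtain ⟨k', hk1, hk2, hk3, hk4'⟩ := ih (k + 1) (by omega)
        refine ⟨k', by omega, hk2, hk3, fun j hj hjk => ?_⟩
        rcases Nat.eq_or_lt_of_le hj with rfl | hlt
        · exact (not_le.mp hk4).le
        · exact hk4' j (by omega) hjk
  have hbar : ∀ k, k ≤ K → A ≤ Y β γ k g₀ := by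
    intro k hk
    obtain ⟨k', hkk', -, hk', hB⟩ := hfirst (K - k) k (by omega)
    have h := hW g₀ k k' hkk' hB
    linarith
  -- the genuine trajectory: clamp inactive, (0.20) solved, in the box, ending at `g`
  set gs : ℕ → ℝ := fun k => gClamp γ (Y β γ k g₀) with hgs
  have hrg : RGEqH K β gs := by
    intro k hk
    show 1 / (gClamp γ (Y β γ k g₀)) ^ 2 = 1 / (gClamp γ (Y β γ (k + 1) g₀)) ^ 2 + β k (prefixOf gs k)
    rw [inv_sq_gClamp hγ (hbar k hk.le), inv_sq_gClamp hγ (hbar (k + 1) hk), Y_succ k g₀]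
    have e : prefixOf gs k = fun j : Fin (k + 1) => gClamp γ (Y β γ j g₀) := rfl
    rw [e]
    ring
  have hI : ∀ k, k ≤ K → 0 < gs k ∧ gs k ≤ γ := fun k _ => ⟨gClamp_pos hγ _, gClamp_le hγ _⟩
  have hgsK : gs K = g := by
    show gClamp γ (Y β γ K g₀) = g
    rw [gClamp_eq_of_le (hbar K le_rfl), hg₀, hYend,
      show (1 : ℝ) / g ^ 2 = (1 / g) ^ 2 by ring, Real.sqrt_sq (by positivity), one_div_one_div]
  have heq : ∀ k, k ≤ K → (C ⟨K, m, gs 0⟩).flow.g k = gs k :=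
    flow_eq_of_rgEqH (C ⟨K, m, gs 0⟩).flow β K (fun k hk => hgen.2 ⟨K, m, gs 0⟩ k hk)
      (hgen.1 ⟨K, m, gs 0⟩) hrg (fun k hk => (hI k hk).1)
  refine ⟨gs 0, fun k hk => ?_, ?_⟩
  · rw [heq k hk]; exact hI k hk
  · rw [heq K le_rfl]; exact hgsK

/-! ## §3 The tuned cooperator has the END -/

/-- **THE TUNED COOPERATOR HAS THE END** · if `b` has bounded drawdown below every line of slope `−2⁻ⁿ` (`n ∈ ℕ`), then EVERY forward-generated
construction of the profile realization `β_{k+1} = b_k + Φ_t(g_k)` (thresholds `coopT`) has `EndpointExistence`, with `γ₂ = 4t_0` and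
`g⋆(γ) = γ∕2`: at the level `n` of the box (`exists_level`) the help is `≥ 2⁻ⁿ` on `[γ∕2, γ]` and `M_n ≤ 3∕γ²` — the barrier shooting lemma.
[cite: Balaban1987RG1, Thm 2 p.259 (first sentence) and (0.20) p.256] -/
theorem endpointExistence_coop (hD : ∀ n : ℕ, DwSeq b (-(((2 : ℝ)⁻¹) ^ n))) {C : B12.Construction}
    (hgen : ForwardGenerated C (betaPro b 1 (coopT hD))) : EndpointExistence C := by
  intro m
  refine ⟨4 * coopT hD 0, by linarith [coopT_pos hD 0], fun γ hγ hγle => ?_⟩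
  obtain ⟨n, htn, hMn⟩ := exists_level hD hγ hγle
  obtain ⟨-, hM⟩ := coopM_spec hD n
  have hM3 : coopM hD n ≤ 3 / γ ^ 2 := by rw [le_div_iff₀ (pow_pos hγ 2)]; exact hMn
  refine ⟨γ / 2, by positivity, fun g hg hgle K => ?_⟩
  exact run_of_bandBarrier (H := fun x => 1 * profile (coopT hD) x) (Hmax := 2) (ε := ((2 : ℝ)⁻¹) ^ n)
    (fun k p hp => betaPro_of_pos b 1 (coopT hD) k hp)
    (betaContH_betaPro b 1 (coopT hD) γ) hγ (fun x _ _ => by linarith [profile_le_two (coopT hD) x])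
    (fun x hx _ => by linarith [le_profile_of_two_mul_le (coopT_pos hD n) (le_trans (by linarith) hx)])
    hM hM3 hgen hg hgle K m

/-- COROLLARY (for `Gaps/EndDrawdownEverySlopeDecided`) · under `∀ n, DwSeq b (−2⁻ⁿ)` there is an every-slope realization of `b` on every box
`]0,γc]` (`0 < γc`), (C) on every box, realised by the tree's canonical forward-generated construction, WITH `EndpointExistence`.
[cite: Balaban1987RG1, Thm 2 p.259 (first sentence) and Thm 3 p.264] -/
theorem exists_everySlope_realization_endpointExistence (hD : ∀ n : ℕ, DwSeq b (-(((2 : ℝ)⁻¹) ^ n))) {γc : ℝ} (hγc : 0 < γc) :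
    ∃ (β : HBeta) (Sβ : B12Beta.OneLoopSplit β), (∀ j, Sβ.β0 j = b j) ∧ EverySlope Sβ γc ∧ (∀ γ, BetaContH γ β) ∧
      ForwardGenerated (modelOf β) β ∧ EndpointExistence (modelOf β) :=
  ⟨betaPro b 1 (coopT hD), splitPro b 1 (coopT hD), fun _ => rfl,
    everySlope_splitPro b 1 (coopT_antitone hD) (coopT_pos hD) hγc, betaContH_betaPro b 1 (coopT hD),
    modelOf_forwardGenerated _, endpointExistence_coop hD (modelOf_forwardGenerated _)⟩

end

end Summit.QuantumFields.BalabanUV.Gaps.EndDrawdownCooperator
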